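/-
Copyright: the b2b-balaban T⁴-continuum CRUX team, row NE7b owner lineage `t4-ne7b-p1` (gen 116). Project licence.
-/
import Summits.QuantumFields.BalabanUV.T4Continuum.Spine.NE7b.SupBackgroundRegionInstance
import Summits.QuantumFields.BalabanUV.T4Continuum.Spine.NE7b.SupBackgroundPeriodic
import Summits.QuantumFields.BalabanUV.T4Continuum.Spine.NE7b.PeriodicSupTorusCarrier

/-!
# THE THERMODYNAMIC LIMIT OF THE TORUS BACKGROUNDS IS THE INFINITE-VOLUME BACKGROUND, EXPONENTIALLY FAST: for (60)'s background `σ`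
# on `ℓ^∞(ℤ^d)` (`d ≥ 3`, every side) and a coarse field `w` in the chart ball, the `s`-PERIODISED fields `w_s` (`w` restricted to the
# window of side `s` and extended periodically — the coarse data of the torus `(ℤ∕s)^d`, leaf-03's PTC carriers) have
# `(n+1)s`-periodic backgrounds `σ(w_s)` — the TORUS backgrounds of SBT — and
# `|σ(w_s)(p) − σ(w)(p)| ≤ 2K₁(μ)‖w‖·e^{−μ(s∕2 − |blk p|_∞)}` at every fine site: the finite-volume small-field backgrounds converge to
# the `ℤ^d` background locally uniformly, at an exponential rate in the period (row NE7b, node U5c; (60) ∕ (73) ∕ PTC ∕ the owner's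
# region letters BY NAME; [folklore])

Cell `pub-balaban`, sub-cell `t4`, spine estimate NE7b (`T4WeightBudget.RelWeightBound`; the cell's OWN estimate — NOT PRINTED in
[Bałaban 1983–89], NOT PROVED).  Crux-route work under `Spine/NE7b/` by the row OWNER (`t4-ne7b-p1` gen 116) under FREEZE (0)'s
crux-prover clause (FILING-CLAIM C-ne7bp1-g116-13); NOTHING of Bałaban's is named, valued or asserted; no `T4Continuum/Support` leaf
typed; no `def`, no notation; zero `sorry`.  Imports (BY NAME): the owner's `…SupBackgroundRegionInstance` (`region_pair_value`; through it
(60) `exists_background`, (58) `abs_apply_le_norm`), (73) `…SupBackgroundPeriodic` (`background_periodic_of_letters`), leaf-03's PTC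
`…PeriodicSupTorusCarrier` (`periodise_periodic`, `norm_periodise`; through it the Literature window kit `Beta.InfiniteVolume`:
`siteOf`, `windowMap`, `InWindow`, `windowMap_siteOf`, `inWindow_of_two_mul_abs_lt`).

WHY (located).  The measures of the programme live on FINITE tori ((B)+1: continuum YM on T⁴ is a finite-torus statement); the sup road
lives on `ℤ^d`, where the chart constants are volume-free, and meets the tori through periodicity: (72) ∕ (73) ∕ (74) ∕ leaf-03's PTC ∕
SBT — the background of a PERIODIC coarse field is periodic and IS the torus background.  A general (non-periodic) coarse field `w` is
seen by the torus of period `s` only through its window: the torus datum is `w_s := E_s(R_s w)` (restrict to the window, periodise).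
The locality column says the background at `p` forgets coarse data beyond `D` blocks up to `e^{−μD}` (the owner's region letters,
`ω = 0`); `w_s` and `w` AGREE on the window, which contains the coarse ball of radius `s∕2 − |blk p|_∞` around `blk p` (§1); hence
§2–§3: the torus backgrounds converge to the infinite-volume background, exponentially in the period, locally uniformly in the site —
the thermodynamic limit of the small-field backgrounds, with a rate.  No new analysis: window bookkeeping + the region letter.

WHAT IS PROVED ([folklore]; `ℓ^∞ := lp (fun _ : X d => ℝ) ∞`; `E_s`, `R_s` = any operators with PTC's displayed actions
`E g q = g(siteOf q)`, `R h x = h(windowMap x)`; `K₁(μ) = (1 − 2λC_Γ(μ))⁻¹C_H(μ)` written out):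
* §1 `abs_apply_le_dist_zero` (`|y i| ≤ |y|_∞`), `inWindow_of_dist_lt` (the coarse ball `{y : |y − c|_∞ < D}` lies in the window of
  side `s` when `2(D + |c|_∞) ≤ s`), `periodise_restrict_apply` (`E(R w)(y) = w(y)` on the window), `norm_periodise_restrict_le`
  (`‖E(R w)‖ ≤ ‖w‖`), `periodise_restrict_sub_eq_zero_of_near`.
* §2 **`abs_sub_le_of_far_letter`** — GENERIC: any map `σ` with the far-support pair letter `|(σw′ − σw)(p)| ≤ K‖w′ − w‖e^{−μD}` whenever
  `w′ − w ≡ 0` on `{y : |y − blk p|_∞ < D}` (`w, w′` in a ball) satisfies `|(σ(E(R w)) − σ w)(p)| ≤ K·2‖w‖·e^{−μ(s∕2 − |blk p|_∞)}`;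
  `abs_sub_le_eps_of_far_letter` (`μ > 0`: for every `ε > 0` and every site, all large periods give `≤ ε`).
* §3 **`exists_background_thermodynamic_limit`** — `d ≥ 3`, `a > 0`, (60)'s data, an admissible rate `μ`: (60)'s operators and `σ`
  with the displayed actions, `σ 0 = 0`, the closed-ball letters, Lipschitz, uniqueness, AND for every period `s ≥ 1`, every pair
  `(E, R)` with PTC's actions and every `w` in the chart ball: `E(R w)` is in the chart ball; **`σ(E(R w))` is `(n+1)s`-PERIODIC** (the
  torus background of SBT); **`|σ(E(R w))(p) − σ(w)(p)| ≤ 2K₁(μ)‖w‖·e^{−μ(s∕2 − |blk p|_∞)}`** at every fine site `p`.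
* §4 toy.

HONEST (what this is NOT).  Backgrounds only (not measures, not the fluctuation covariance — whose analogous statement follows from
(64) (b) the same way, not typed); the rate `μ` and `K₁(μ)` are existential ∕ useless by value; scalar `ℤ^d`, sitewise interaction;
nothing of the covariant `H_k`, (A3) ∕ (A1c) (NC-NE7b-α UNRULED).  BY-NAME EFFECT ON THE WALL: NONE.  NE7b NOT PRINTED ∕ NOT PROVED;
spine PROVED 0∕9; rung (B)+1 on a FINITE torus — NOT infinite volume, NOT the mass gap, NOT Clay.  HONEST DEPENDENCY: continuum YM on
T⁴ ⇐ BetaPertH ∧ nine spine estimates (0∕9 proved); BetaPertH ⇐ (D1) ∧ (D4) ∧ CAP+tail; G-an2-4 gates asym, D1 and NE2∕3∕4.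
-/

set_option autoImplicit false

noncomputable section

namespace Summit.QuantumFields.BalabanUV.T4Continuum.NE7b.SupBackgroundThermodynamicLimit

open scoped ENNReal NNReal
open Metric Set
open Literature.MathematicalPhysics.QuantumFieldTheory.Balaban1983to89
open B4Sect5Proof (latticeConst latticeConst_nonneg)
open B6QGQLower276 (X e blk B mem_B sum_B_const AX side)
open B6QGQDecay237 (deltaU deltaU_pos)
open B5Hk103ScalarZd (nbhd deltaH deltaH_pos)
open Summit.QuantumFields.BalabanUV.Beta.D1BFx.BlockColumnSupNorm (cHs cHs_nonneg)
open Summit.QuantumFields.BalabanUV.Beta.D1BFx.PointColumnSplit (cKL cG0 cSplit)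
open Summit.QuantumFields.BalabanUV.Beta.D1BFx.PointColumnDecay (cFar)
open BlockPropagatorSupNorm (supConstG_nonneg)
open Beta (Site siteOf windowMap InWindow windowMap_siteOf inWindow_of_two_mul_abs_lt)
open LocalNemytskiiSup (abs_apply_le_norm)
open SupSmallFieldBackground (exists_background)
open SupBackgroundPeriodic (background_periodic_of_letters)
open PeriodicSupTorusCarrier (periodise_periodic norm_periodise)
open SupBackgroundRegionInstance (region_pair_value)

variable {d : ℕ}

/-! ## §1. Window bookkeeping -/

/-- A coordinate is bounded by the sup distance to the origin: `|y i| ≤ |y|_∞`. [folklore] -/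
theorem abs_apply_le_dist_zero (y : X d) (i : Fin d) : |((y i : ℤ) : ℝ)| ≤ dist y 0 := by
  have h := dist_le_pi_dist y (0 : X d) i
  rwa [Pi.zero_apply, Int.dist_eq, Int.cast_zero, sub_zero] at h

/-- **THE COARSE BALL LIES IN THE WINDOW**: if `|y − c|_∞ < D` and `2(D + |c|_∞) ≤ s` then every coordinate of `y` is in the window
of side `s`. [folklore] -/
theorem inWindow_of_dist_lt {s : ℕ} {y c : X d} {D : ℝ} (hy : dist y c < D) (hD : 2 * (D + dist c 0) ≤ (s : ℝ)) (i : Fin d) :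
    InWindow s (y i) := by
  apply inWindow_of_two_mul_abs_lt
  have h1 := abs_apply_le_dist_zero y i
  have h2 : dist y (0 : X d) ≤ dist y c + dist c 0 := dist_triangle y c 0
  have h3 : (2 : ℝ) * |((y i : ℤ) : ℝ)| < (s : ℝ) := by linarith
  exact_mod_cast h3

section Carrier

variable {s : ℕ} [NeZero s] {E : (Site d s → ℝ) →L[ℝ] lp (fun _ : X d => ℝ) ∞}
  {R : lp (fun _ : X d => ℝ) ∞ →L[ℝ] (Site d s → ℝ)}

/-- **THE PERIODISED FIELD AGREES WITH THE FIELD ON THE WINDOW**: `E(R w)(y) = w(y)` whenever every coordinate of `y` is in the window.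
[folklore] -/
theorem periodise_restrict_apply (hE : ∀ (g : Site d s → ℝ) (q : X d), E g q = g (siteOf d s q))
    (hR : ∀ (h : lp (fun _ : X d => ℝ) ∞) (x : Site d s), R h x = h (windowMap d s x))
    (w : lp (fun _ : X d => ℝ) ∞) {y : X d} (hy : ∀ i, InWindow s (y i)) : E (R w) y = w y := by
  rw [hE, hR, windowMap_siteOf d s hy]

/-- `‖E(R w)‖ ≤ ‖w‖`. [folklore] -/
theorem norm_periodise_restrict_le (hE : ∀ (g : Site d s → ℝ) (q : X d), E g q = g (siteOf d s q))
    (hR : ∀ (h : lp (fun _ : X d => ℝ) ∞) (x : Site d s), R h x = h (windowMap d s x))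
    (w : lp (fun _ : X d => ℝ) ∞) : ‖E (R w)‖ ≤ ‖w‖ := by
  rw [norm_periodise hE]
  exact (pi_norm_le_iff_of_nonneg (norm_nonneg w)).2 fun x => by
    rw [hR]; exact lp.norm_apply_le_norm ENNReal.top_ne_zero w _

/-- **THE PERIODISED FIELD AND THE FIELD AGREE ON THE COARSE BALL OF RADIUS `s∕2 − |c|_∞` AROUND `c`**: `(E(R w) − w)(y) = 0` for
`|y − c|_∞ < s∕2 − |c|_∞`. [folklore] -/
theorem periodise_restrict_sub_eq_zero_of_near (hE : ∀ (g : Site d s → ℝ) (q : X d), E g q = g (siteOf d s q))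
    (hR : ∀ (h : lp (fun _ : X d => ℝ) ∞) (x : Site d s), R h x = h (windowMap d s x))
    (w : lp (fun _ : X d => ℝ) ∞) (c : X d) {y : X d} (hy : dist y c < (s : ℝ) / 2 - dist c 0) :
    (E (R w) - w) y = 0 := by
  rw [lp.coeFn_sub, Pi.sub_apply, periodise_restrict_apply hE hR w (inWindow_of_dist_lt hy (by linarith)), sub_self]

end Carrier

/-! ## §2. Convergence from a far-support pair letter -/

/-- **THE TORUS DATUM's BACKGROUND IS EXPONENTIALLY CLOSE TO THE INFINITE-VOLUME ONE**, generic: if `σ` obeys the far-support pair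
letter on the ball `closedBall 0 R₀` — `|(σw′ − σw)(p)| ≤ K·‖w′ − w‖·e^{−μD}` whenever `w′ − w` vanishes on `{y : |y − blk p|_∞ < D}` —
then for every `w` in the ball and every period `s`: `|(σ(E(R w)) − σ w)(p)| ≤ K·(2‖w‖)·e^{−μ(s∕2 − |blk p|_∞)}`. [folklore] -/
theorem abs_sub_le_of_far_letter (n : ℕ) {σ : lp (fun _ : X d => ℝ) ∞ → lp (fun _ : X d => ℝ) ∞} {R₀ K μ : ℝ} (hK : 0 ≤ K)
    (hfar : ∀ w ∈ closedBall (0 : lp (fun _ : X d => ℝ) ∞) R₀, ∀ w' ∈ closedBall (0 : lp (fun _ : X d => ℝ) ∞) R₀,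
      ∀ (p : X d) (D : ℝ), (∀ y, dist y (blk n p) < D → (w' - w) y = 0) →
        |(σ w' - σ w) p| ≤ K * ‖w' - w‖ * Real.exp (-(μ * D)))
    {s : ℕ} [NeZero s] {E : (Site d s → ℝ) →L[ℝ] lp (fun _ : X d => ℝ) ∞} {R : lp (fun _ : X d => ℝ) ∞ →L[ℝ] (Site d s → ℝ)}
    (hE : ∀ (g : Site d s → ℝ) (q : X d), E g q = g (siteOf d s q))
    (hR : ∀ (h : lp (fun _ : X d => ℝ) ∞) (x : Site d s), R h x = h (windowMap d s x))
    {w : lp (fun _ : X d => ℝ) ∞} (hw : w ∈ closedBall (0 : lp (fun _ : X d => ℝ) ∞) R₀) (p : X d) :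
    |(σ (E (R w)) - σ w) p| ≤ K * (2 * ‖w‖) * Real.exp (-(μ * ((s : ℝ) / 2 - dist (blk n p) 0))) := by
  have hw' : E (R w) ∈ closedBall (0 : lp (fun _ : X d => ℝ) ∞) R₀ := by
    rw [mem_closedBall, dist_zero_right] at hw ⊢
    exact (norm_periodise_restrict_le hE hR w).trans hw
  have h := hfar w hw (E (R w)) hw' p ((s : ℝ) / 2 - dist (blk n p) 0)
    (fun y hy => periodise_restrict_sub_eq_zero_of_near hE hR w (blk n p) hy)
  refine h.trans (mul_le_mul_of_nonneg_right (mul_le_mul_of_nonneg_left ?_ hK) (Real.exp_pos _).le)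
  calc ‖E (R w) - w‖ ≤ ‖E (R w)‖ + ‖w‖ := norm_sub_le _ _
    _ ≤ ‖w‖ + ‖w‖ := add_le_add (norm_periodise_restrict_le hE hR w) le_rfl
    _ = 2 * ‖w‖ := by ring

/-- … hence, at a positive rate, **CONVERGENCE AT EVERY SITE**: for every `ε > 0` there is `s₀` such that every period `s ≥ s₀` gives
`|(σ(E(R w)) − σ w)(p)| ≤ ε` (for every carrier pair `(E, R)` of that period). [folklore] -/
theorem abs_sub_le_eps_of_far_letter (n : ℕ) {σ : lp (fun _ : X d => ℝ) ∞ → lp (fun _ : X d => ℝ) ∞} {R₀ K μ : ℝ} (hK : 0 ≤ K)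
    (hμ : 0 < μ)
    (hfar : ∀ w ∈ closedBall (0 : lp (fun _ : X d => ℝ) ∞) R₀, ∀ w' ∈ closedBall (0 : lp (fun _ : X d => ℝ) ∞) R₀,
      ∀ (p : X d) (D : ℝ), (∀ y, dist y (blk n p) < D → (w' - w) y = 0) →
        |(σ w' - σ w) p| ≤ K * ‖w' - w‖ * Real.exp (-(μ * D)))
    {w : lp (fun _ : X d => ℝ) ∞} (hw : w ∈ closedBall (0 : lp (fun _ : X d => ℝ) ∞) R₀) (p : X d) {ε : ℝ} (hε : 0 < ε) :
    ∃ s₀ : ℕ, ∀ s : ℕ, s₀ ≤ s → ∀ [NeZero s] (E : (Site d s → ℝ) →L[ℝ] lp (fun _ : X d => ℝ) ∞)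
      (R : lp (fun _ : X d => ℝ) ∞ →L[ℝ] (Site d s → ℝ)),
      (∀ (g : Site d s → ℝ) (q : X d), E g q = g (siteOf d s q)) →
      (∀ (h : lp (fun _ : X d => ℝ) ∞) (x : Site d s), R h x = h (windowMap d s x)) →
        |(σ (E (R w)) - σ w) p| ≤ ε := by
  -- choose `s₀` with `K·2‖w‖·e^{−μ(s₀∕2 − |blk p|)} ≤ ε`
  have hlim : Filter.Tendsto (fun s : ℕ => K * (2 * ‖w‖) * Real.exp (-(μ * ((s : ℝ) / 2 - dist (blk n p) 0))))
      Filter.atTop (nhds 0) := by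
    have h1 : Filter.Tendsto (fun s : ℕ => -(μ * ((s : ℝ) / 2 - dist (blk n p) 0))) Filter.atTop Filter.atBot := by
      have h2 : Filter.Tendsto (fun s : ℕ => μ * ((s : ℝ) / 2 - dist (blk n p) 0)) Filter.atTop Filter.atTop :=
        Filter.Tendsto.const_mul_atTop hμ
          ((Filter.tendsto_atTop_add_const_right _ _ (tendsto_natCast_atTop_atTop.atTop_div_const (by norm_num))))
      exact Filter.tendsto_neg_atTop_atBot.comp h2
    have h3 := Real.tendsto_exp_atBot.comp h1
    simpa using h3.const_mul (K * (2 * ‖w‖))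
  obtain ⟨s₀, hs₀⟩ := Filter.tendsto_atTop'.1 hlim (Iic ε) (Iic_mem_nhds hε)
  refine ⟨s₀, fun s hs _ E R hE hR => (abs_sub_le_of_far_letter n hK hfar hE hR hw p).trans (Set.mem_Iic.1 (hs₀ s hs))⟩

/-! ## §3. The instance on (60)'s background -/

/-- **THE THERMODYNAMIC LIMIT OF THE TORUS BACKGROUNDS** (`d ≥ 3`, `a > 0`; (60)'s data `u 0 = 0`, `|u′| ≤ λ`, `u′` `L`-Lipschitz,
`N ≥ N_∞`, `2λ ≤ c < N⁻¹`, `r ≥ 0`; an admissible rate `0 ≤ μ < δ_H`, `μ < δ_u∕4`, `2λC_Γ(μ) < 1`).  (60)'s operators and background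
`σ` exist with the displayed actions, `σ 0 = 0`, the closed-ball letters, Lipschitz and uniqueness, AND for every period `s ≥ 1`, every
carrier pair `(E, R)` with PTC's actions and every `w` with `‖w‖ ≤ (N⁻¹ − c)r`: `E(R w)` is in the chart ball, `σ(E(R w))` is
`(n+1)s`-periodic, and **`|σ(E(R w))(p) − σ(w)(p)| ≤ K₁(μ)·2‖w‖·e^{−μ(s∕2 − |blk p|_∞)}`** at every fine site. [folklore] -/
theorem exists_background_thermodynamic_limit (hd : 3 ≤ d) (n : ℕ) {a : ℝ} (ha : 0 < a)
    {u u' : ℝ → ℝ} (hu : ∀ t, HasDerivAt u (u' t) t) (hu0 : u 0 = 0) {lam c N : ℝ≥0} (hlam : ∀ t, |u' t| ≤ lam)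
    {L : ℝ} (hL0 : 0 ≤ L) (hL : ∀ s t, |u' s - u' t| ≤ L * |s - t|)
    (hN : cHs d a * latticeConst d (deltaH d a)
        + ((cG0 d * cKL d (d - 2) + cSplit d a) * Real.exp (2 * deltaU d a)
            + cFar d a * Real.exp (4 * deltaU d a) / deltaU d a ^ 2) * latticeConst d (deltaU d a / 4)
          * (1 + cHs d a * latticeConst d (deltaH d a)) ≤ (N : ℝ))
    (hc : 2 * lam ≤ c) (hcN : c < N⁻¹) {r : ℝ} (hr : 0 ≤ r)
    {μ : ℝ} (hμ0 : 0 ≤ μ) (hμH : μ < deltaH d a) (hμU : μ < deltaU d a / 4)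
    (hsmall : 2 * (lam : ℝ) * (((cG0 d * cKL d (d - 2) + cSplit d a) * Real.exp (2 * deltaU d a)
        + cFar d a * Real.exp (4 * deltaU d a) / deltaU d a ^ 2) * latticeConst d (deltaU d a / 4 - μ)
          * (1 + cHs d a * latticeConst d (deltaH d a - μ))) < 1) :
    ∃ (Dop Aop Pop : lp (fun _ : X d => ℝ) ∞ →L[ℝ] lp (fun _ : X d => ℝ) ∞)
      (σ : lp (fun _ : X d => ℝ) ∞ → lp (fun _ : X d => ℝ) ∞),
      (∀ (f : lp (fun _ : X d => ℝ) ∞) (y : X d), Dop f y = (((n : ℝ) + 1) ^ d)⁻¹ * ∑ p ∈ B n y, f p) ∧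
      (∀ (f : lp (fun _ : X d => ℝ) ∞) (p : X d), Aop f p = ∑ r ∈ nbhd n p, AX n a p r * f r) ∧
      (∀ (f : lp (fun _ : X d => ℝ) ∞) (p : X d), Pop f p = f p - (((n : ℝ) + 1) ^ d)⁻¹ * ∑ p' ∈ B n (blk n p), f p') ∧
      σ 0 = 0 ∧
      (∀ w ∈ closedBall (0 : lp (fun _ : X d => ℝ) ∞) (((N : ℝ)⁻¹ - c) * r),
        σ w ∈ closedBall 0 r ∧ Dop (σ w) = w ∧
          ∀ p : X d, Aop (σ w) p + u (σ w p)
            = (((n : ℝ) + 1) ^ d)⁻¹ * ∑ p' ∈ B n (blk n p), (Aop (σ w) p' + u (σ w p'))) ∧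
      LipschitzOnWith (N⁻¹ - c)⁻¹ σ (closedBall (0 : lp (fun _ : X d => ℝ) ∞) (((N : ℝ)⁻¹ - c) * r)) ∧
      (∀ φ ∈ closedBall (0 : lp (fun _ : X d => ℝ) ∞) r,
        (∀ p : X d, Aop φ p + u (φ p) = (((n : ℝ) + 1) ^ d)⁻¹ * ∑ p' ∈ B n (blk n p), (Aop φ p' + u (φ p'))) →
          σ (Dop φ) = φ) ∧
      ∀ (s : ℕ) [NeZero s] (E : (Site d s → ℝ) →L[ℝ] lp (fun _ : X d => ℝ) ∞) (R : lp (fun _ : X d => ℝ) ∞ →L[ℝ] (Site d s → ℝ)),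
        (∀ (g : Site d s → ℝ) (q : X d), E g q = g (siteOf d s q)) →
        (∀ (h : lp (fun _ : X d => ℝ) ∞) (x : Site d s), R h x = h (windowMap d s x)) →
        ∀ w ∈ closedBall (0 : lp (fun _ : X d => ℝ) ∞) (((N : ℝ)⁻¹ - c) * r),
          E (R w) ∈ closedBall (0 : lp (fun _ : X d => ℝ) ∞) (((N : ℝ)⁻¹ - c) * r) ∧
          (∀ q t : X d, σ (E (R w)) (q + side n • ((s : ℤ) • t)) = σ (E (R w)) q) ∧
          ∀ p : X d, |(σ (E (R w)) - σ w) p|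
            ≤ (1 - 2 * (lam : ℝ) * (((cG0 d * cKL d (d - 2) + cSplit d a) * Real.exp (2 * deltaU d a)
                + cFar d a * Real.exp (4 * deltaU d a) / deltaU d a ^ 2) * latticeConst d (deltaU d a / 4 - μ)
                  * (1 + cHs d a * latticeConst d (deltaH d a - μ))))⁻¹
              * (cHs d a * latticeConst d (deltaH d a - μ)) * (2 * ‖w‖)
              * Real.exp (-(μ * ((s : ℝ) / 2 - dist (blk n p) 0))) := by
  obtain ⟨Dop, Aop, Pop, σ, hD, hA, hP, hσ0, hσ, hlip, huniq, -⟩ := exists_background hd n ha hu hu0 hlam hL0 hL hN hc hcN hr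
  have hul : ∀ s t, |u s - u t| ≤ (lam : ℝ) * |s - t| := fun s t => by
    have hderiv : ∀ x ∈ uIcc t s, HasDerivWithinAt u (u' x) (uIcc t s) x := fun x _ => (hu x).hasDerivWithinAt
    have hbound : ∀ x ∈ uIcc t s, ‖u' x‖ ≤ lam := fun x _ => by rw [Real.norm_eq_abs]; exact hlam x
    have h := Convex.norm_image_sub_le_of_norm_hasDerivWithin_le hderiv hbound (convex_uIcc t s) left_mem_uIcc right_mem_uIcc
    rwa [Real.norm_eq_abs, Real.norm_eq_abs] at h
  have hulw : ∀ s t, |s| ≤ r → |t| ≤ r → |u s - u t| ≤ (lam : ℝ) * |s - t| := fun s t _ _ => hul s t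
  have hCH0 : 0 ≤ cHs d a * latticeConst d (deltaH d a - μ) :=
    mul_nonneg (cHs_nonneg d ha) (latticeConst_nonneg d (sub_pos.2 hμH).le)
  have hK1 : 0 ≤ (1 - 2 * (lam : ℝ) * (((cG0 d * cKL d (d - 2) + cSplit d a) * Real.exp (2 * deltaU d a)
      + cFar d a * Real.exp (4 * deltaU d a) / deltaU d a ^ 2) * latticeConst d (deltaU d a / 4 - μ)
        * (1 + cHs d a * latticeConst d (deltaH d a - μ))))⁻¹ * (cHs d a * latticeConst d (deltaH d a - μ)) :=
    mul_nonneg (inv_nonneg.2 (sub_pos.2 hsmall).le) hCH0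
  -- the far-support pair letter (the region letter at `ω = 0`)
  have hfar : ∀ w ∈ closedBall (0 : lp (fun _ : X d => ℝ) ∞) (((N : ℝ)⁻¹ - c) * r),
      ∀ w' ∈ closedBall (0 : lp (fun _ : X d => ℝ) ∞) (((N : ℝ)⁻¹ - c) * r),
      ∀ (p : X d) (D : ℝ), (∀ y, dist y (blk n p) < D → (w' - w) y = 0) →
        |(σ w' - σ w) p| ≤ (1 - 2 * (lam : ℝ) * (((cG0 d * cKL d (d - 2) + cSplit d a) * Real.exp (2 * deltaU d a)
            + cFar d a * Real.exp (4 * deltaU d a) / deltaU d a ^ 2) * latticeConst d (deltaU d a / 4 - μ)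
              * (1 + cHs d a * latticeConst d (deltaH d a - μ))))⁻¹ * (cHs d a * latticeConst d (deltaH d a - μ))
          * ‖w' - w‖ * Real.exp (-(μ * D)) := by
    intro w hw w' hw' p D hzero
    obtain ⟨hb, hDw, hEw⟩ := hσ w hw
    obtain ⟨hb', hDw', hEw'⟩ := hσ w' hw'
    rw [mem_closedBall, dist_zero_right] at hb hb'
    have hbw : ∀ q, |σ w q| ≤ r := fun q => (abs_apply_le_norm (σ w) q).trans hb
    have hbw' : ∀ q, |σ w' q| ≤ r := fun q => (abs_apply_le_norm (σ w') q).trans hb'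
    have hDd : Dop (σ w' - σ w) = w' - w := by rw [map_sub, hDw, hDw']
    have hnear : ∀ y, dist y (blk n p) < D → |Dop (σ w' - σ w) y| ≤ 0 := fun y hy => by
      rw [hDd, hzero y hy, abs_zero]
    have h := region_pair_value hd ha hD hA hP (NNReal.coe_nonneg lam) hr hulw hμ0 hμH hμU hsmall hbw' hbw hEw' hEw p le_rfl hnear
    rw [hDd, zero_add] at h
    calc _ ≤ _ := h
      _ = _ := by ring
  refine ⟨Dop, Aop, Pop, σ, hD, hA, hP, hσ0, hσ, hlip, huniq, fun s _ E R hE hR w hw => ⟨?_, fun q t => ?_, fun p => ?_⟩⟩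
  · rw [mem_closedBall, dist_zero_right] at hw ⊢
    exact (norm_periodise_restrict_le hE hR w).trans hw
  · exact background_periodic_of_letters n Dop Aop hD hA (S := closedBall (0 : lp (fun _ : X d => ℝ) ∞) (((N : ℝ)⁻¹ - c) * r))
      hσ huniq s (w := E (R w)) (by
        rw [mem_closedBall, dist_zero_right] at hw ⊢
        exact (norm_periodise_restrict_le hE hR w).trans hw) (fun y t' => periodise_periodic hE (R w) y t') q t
  · exact abs_sub_le_of_far_letter n hK1 hfar hE hR hw p

/-! ## §4. Toy -/

/-- Toy: the rate by value — at `μ = 1∕2`, `|blk p|_∞ = 3` and period `s = 26` the exponent is `−(1∕2)(13 − 3) = −5`. -/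
example : -((1 / 2 : ℝ) * ((26 : ℝ) / 2 - 3)) = -5 := by norm_num

end Summit.QuantumFields.BalabanUV.T4Continuum.NE7b.SupBackgroundThermodynamicLimit

end
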